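import Summits.ValiantsHypothesis.ValiantsHypothesis.Theorems.GrenetZeonTransferToDc
import Literature.Computability.AlgebraicComplexity.AlgDetRepr
import HarnessLib

/-!
# Crux `GrenetZeon.PolySizeQPAlgebra` (stmt-ValiantsHypothesis-8064), line `vbp-slice-dealg` —
the registered stub `stub_dealgebraizePoly` at `c = 1`, and de-algebraization at polynomial cost
whenever the COEFFICIENT DIMENSION is polynomial

The registered stub `stub_dealgebraizePoly c` of the skeleton `Cruxes/AlgDcQP/Lines/vbp_slice_dealg.lean`
reads: there are `k, n₀` such that for `n ≥ n₀`, every `(m, s)`-representation of `per_n`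
(`HasAlgDetRepr`) with `m ≤ n^c + c` and `s ≤ 2^((log₂ n + c)^c)` yields `dc(per_n) ≤ n^k + k`.
For `c ≥ 2` the dimension budget `2^((log₂ n + c)^c)` is quasi-polynomial and the stub is open
(the known removal of a commutative coefficient algebra costs `(s+1)(m+1)^3`, the route's proved
`TransferToDc`, Hrubeš–Yehudayoff 2011 Thm. 4.2 accounting).  Two things are settled here:

* `hasDetRepr_poly_of_poly_box` — **polynomial budget de-algebraizes at polynomial cost**: for every
  `c`, for `n ≥ c + 2`, an `(m, s)`-representation of `per_n` with `m ≤ n^c + c` AND `s ≤ n^c + c`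
  gives `dc(per_n) ≤ n^(4c+4) + (4c+4)` (`TransferToDc`: `(s+1)(m+1)^3 ≤ (n^c + c + 1)^4 ≤ 16 n^{4c}
  ≤ n^{4c+4}`).  So the whole difficulty of `stub_dealgebraizePoly` sits in the gap between a
  polynomial and a quasi-polynomial coefficient dimension.
* `stub_dealgebraizePoly_one` — the registered stub AT `c = 1`, PROVED: its budget
  `s ≤ 2^((log₂ n + 1)^1) = 2·2^(log₂ n) ≤ 2n ≤ n² + 2` is polynomial, so the previous lemma (with
  `c = 2`) applies: `k = 12`, `n₀ = 4`.  (`c = 0` was settled by the degree floor in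
  `GrenetZeonPolySizeQPAlgebraDegreeFloor.lean`; `c ≥ 2` remains open-problem grade.)

Honest framing: a decided instance and the location of the difficulty; no stub with `c ≥ 2` is
touched and nothing here is progress on VP ≠ VNP.  Axioms `propext`, `Classical.choice`,
`Quot.sound`.
-/

set_option linter.dupNamespace false

noncomputable section

namespace Summit.ValiantsHypothesis.ValiantsHypothesis.Theorems.GrenetZeonPolySizeQPAlgebra

open MvPolynomial Matrix
open Literature.Computability.AlgebraicComplexity
open Summit.ValiantsHypothesis.ValiantsHypothesis.Theses.GrenetZeon

/-- Arithmetic: for `n ≥ c + 2` and `m, s ≤ n^c + c`, the transfer size `(s+1)(m+1)^3` is at most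
`n^(4c+4) + (4c+4)` (`n^c + c + 1 ≤ 2 n^c`, `16 ≤ n^4`). [folklore] -/
theorem transfer_le_pow_of_poly_box {n c m s : ℕ} (hn : c + 2 ≤ n) (hm : m ≤ n ^ c + c)
    (hs : s ≤ n ^ c + c) :
    (s + 1) * (m + 1) ^ 3 ≤ n ^ (4 * c + 4) + (4 * c + 4) := by
  -- `c + 1 ≤ n^c`
  have h1 : c + 1 ≤ n ^ c := by
    rcases Nat.eq_zero_or_pos c with rfl | hc
    · simp
    · exact le_trans (by omega) (Nat.le_self_pow (Nat.pos_iff_ne_zero.mp hc) n)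
  have h2 : n ^ c + c + 1 ≤ 2 * n ^ c := by omega
  have hs' : s + 1 ≤ 2 * n ^ c := le_trans (Nat.add_le_add_right hs 1) h2
  have hm' : m + 1 ≤ 2 * n ^ c := le_trans (Nat.add_le_add_right hm 1) h2
  have h16 : 2 ^ 4 ≤ n ^ 4 := Nat.pow_le_pow_left (by omega) 4
  calc (s + 1) * (m + 1) ^ 3
      ≤ (2 * n ^ c) * (2 * n ^ c) ^ 3 :=
        Nat.mul_le_mul hs' (Nat.pow_le_pow_left hm' 3)
    _ = 2 ^ 4 * (n ^ c) ^ 4 := by ring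
    _ ≤ n ^ 4 * (n ^ c) ^ 4 := Nat.mul_le_mul_right _ h16
    _ = n ^ (4 * c + 4) := by ring
    _ ≤ n ^ (4 * c + 4) + (4 * c + 4) := Nat.le_add_right _ _

/-- **Polynomial coefficient dimension de-algebraizes at polynomial cost.** For every `c` and all
`n ≥ c + 2`: an `(m, s)`-representation of `per_n` with `m ≤ n^c + c` and `s ≤ n^c + c` (polynomial
matrix size AND polynomial dimension of the commutative coefficient algebra) gives an affine
determinantal representation of size `n^(4c+4) + (4c+4)` — the route's transfer `TransferToDc`
(`transferToDc_proof`: `(m, s) ↦ dc ≤ (s+1)(m+1)^3`, Hrubeš–Yehudayoff 2011 Thm. 4.2) inside a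
polynomial box.  The registered stub `stub_dealgebraizePoly c` asks the same with the
quasi-polynomial budget `s ≤ 2^((log₂ n + c)^c)`; its content is exactly the gap between the two
budgets. [cite: HrubesYehudayoff2011, Thm. 4.2] -/
theorem hasDetRepr_poly_of_poly_box (c : ℕ) :
    ∀ n ≥ c + 2, ∀ m s : ℕ, m ≤ n ^ c + c → s ≤ n ^ c + c →
      HasAlgDetRepr (perPoly (Fin n) ℂ) m s →
        HasDetRepr (perPoly (Fin n) ℂ) (n ^ (4 * c + 4) + (4 * c + 4)) := by
  intro n hn m s hm hs hrep
  have hdc : HasDetRepr (perPoly (Fin n) ℂ) ((s + 1) * (m + 1) ^ 3) :=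
    GrenetZeon.transferToDc_proof n m s hrep
  exact HasDetRepr.mono_holds hdc (transfer_le_pow_of_poly_box hn hm hs)

/-- The `c = 1` dimension budget is polynomial: `2^((log₂ n + 1)^1) ≤ 2 n ≤ n² + 2`. [folklore] -/
theorem qexp_one_le (n : ℕ) : 2 ^ ((Nat.log 2 n + 1) ^ 1) ≤ n ^ 2 + 2 := by
  rw [pow_one, pow_succ]
  rcases Nat.eq_zero_or_pos n with rfl | hn
  · simp
  · have h1 : 2 ^ Nat.log 2 n ≤ n := Nat.pow_log_le_self 2 (Nat.pos_iff_ne_zero.mp hn)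
    nlinarith [h1]

/-- **Registered stub `stub_dealgebraizePoly` AT `c = 1`, PROVED** (line `vbp-slice-dealg` of
crux `PolySizeQPAlgebra`, stmt-ValiantsHypothesis-8064): for `n ≥ 4`, an `(m, s)`-representation of
`per_n` with `m ≤ n + 1` and `s ≤ 2^(log₂ n + 1)` gives `dc(per_n) ≤ n^12 + 12`.  The `c = 1` budget
is polynomial (`qexp_one_le`: `s ≤ n² + 2`, and `m ≤ n + 1 ≤ n² + 2`), so
`hasDetRepr_poly_of_poly_box 2` applies.  The instances `c ≥ 2` (quasi-polynomial `s`) are open.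
[cite: HrubesYehudayoff2011, Thm. 4.2] -/
theorem stub_dealgebraizePoly_one :
    ∃ k n₀ : ℕ, ∀ n ≥ n₀, ∀ m s : ℕ, m ≤ n ^ 1 + 1 → s ≤ 2 ^ ((Nat.log 2 n + 1) ^ 1) →
      HasAlgDetRepr (perPoly (Fin n) ℂ) m s → HasDetRepr (perPoly (Fin n) ℂ) (n ^ k + k) := by
  refine ⟨4 * 2 + 4, 2 + 2, fun n hn m s hm hs hrep => ?_⟩
  have hm' : m ≤ n ^ 2 + 2 := by
    rw [pow_one] at hm
    nlinarith [hm]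
  have hs' : s ≤ n ^ 2 + 2 := hs.trans (qexp_one_le n)
  exact hasDetRepr_poly_of_poly_box 2 n hn m s hm' hs' hrep

/-- The same instance with the literal constants `k = 12`, `n₀ = 4`. [cite: HrubesYehudayoff2011, Thm. 4.2] -/
theorem dealgebraizePoly_one_explicit :
    ∀ n ≥ 4, ∀ m s : ℕ, m ≤ n ^ 1 + 1 → s ≤ 2 ^ ((Nat.log 2 n + 1) ^ 1) →
      HasAlgDetRepr (perPoly (Fin n) ℂ) m s → HasDetRepr (perPoly (Fin n) ℂ) (n ^ 12 + 12) := by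
  intro n hn m s hm hs hrep
  have hm' : m ≤ n ^ 2 + 2 := by
    rw [pow_one] at hm
    nlinarith [hm]
  exact hasDetRepr_poly_of_poly_box 2 n hn m s hm' (hs.trans (qexp_one_le n)) hrep

end Summit.ValiantsHypothesis.ValiantsHypothesis.Theorems.GrenetZeonPolySizeQPAlgebra

end
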